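import Mathlib
import Literature.Probability.RandomMatrix.SphereCoordinateDensity

/-!
# Husimi concentration, II: Gaussian integrals on `ι → ℂ`

Part of the proof, for route `BECHusimiAmplitudeGas` of `AtomisticToContinuum/BoseEinsteinCondensation`,
that the Laplace-principle node `HusimiConcentration` (item stmt-AtomisticToContinuum-11994) follows
from the two cap estimates `PhaseCapDecay` (stmt-11990) and `AmplitudeLDP` (stmt-11991) — the
content of the glue item `LaplaceCapUnion` (stmt-11995). Setting (generic over a finite index type
`ι` of modes with an injective labelling `m : ι → ℤ³`, `m i₀ = 0`): scaled plane waves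
`e_i = e_{m i}/√L³` on the cell `[0,L)³`, `u_c = ∑ᵢ cᵢ eᵢ` for `c : ι → ℂ`, the degree-`N` form
`F(g) = ∫_{cell^N} ∏ⱼ conj g(xⱼ) Ψ(X) dX`, the Gaussian weight `w(c) = e^{-∑|cᵢ|²}` on
`ι → ℂ ≅ ℝ^{2|ι|}` (Lebesgue measure), and the word integrals
`J_k = ∫_{cell^N} ∏ⱼ conj e_{kⱼ}(xⱼ) Ψ` for words `k : Fin N → ι`.

This file (pure measure theory on `ι → ℂ` with Lebesgue measure `volume`, no Bose-gas objects):
* `lintegral_exp_neg_nsq` : `∫ e^{-∑|cᵢ|²} dc = π^{|ι|}` (from the product Gaussian law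
  `gaussianPi` of `Literature.Probability.RandomMatrix` having this density);
* `lintegral_exp_neg_nsq_mul_pow_lt_top` : all moments `∫ e^{-S} Sᵖ < ∞`, `S = ∑|cᵢ|²`;
* `radial_lintegral_le` : for measurable `G ≥ 0`, homogeneous of degree `2p` under real
  dilations, with `∫ e^{-S} G < ∞`: `(p + |ι|) ∫ e^{-S} G ≤ ∫ e^{-S} S G` — the radial
  ("polar integration") identity behind the factor `N + d` in the Laplace bookkeeping, proved by
  the dilation `c ↦ √t c` of Lebesgue measure (`Measure.map_addHaar_smul` through
  `lintegral_eq_pow_mul_lintegral_smul`), `1 - e^{-x} ≤ x`, Bernoulli, and `t ↓ 1`;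
* `measurePreserving_rotate_coord` : rotating one coordinate by a unit complex number preserves
  Lebesgue measure (product of the isometry `z ↦ az` of `ℂ ≅ ℝ²` with identities).
All [folklore].
-/

noncomputable section

namespace Summit.AtomisticToContinuum.BoseEinsteinCondensation.Theorems

open MeasureTheory
open scoped ENNReal NNReal ComplexConjugate BigOperators
open Literature.Probability.RandomMatrix

namespace HusimiConcentration

variable {ι : Type*} [Fintype ι]


/-- **The Gaussian integral on `ι → ℂ`**: `∫ e^{-∑ᵢ|cᵢ|²} dc = π^{|ι|}` (Lebesgue measure on
`ι → ℂ ≅ ℝ^{2|ι|}`; read off from the density of the product standard complex Gaussian law). [folklore] -/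
theorem lintegral_exp_neg_nsq :
    ∫⁻ c : ι → ℂ, ENNReal.ofReal (Real.exp (-∑ i, ‖c i‖ ^ 2)) =
      ENNReal.ofReal (Real.pi ^ Fintype.card ι) := by
  have h1 : (gaussianPi ι) Set.univ = 1 := measure_univ
  rw [gaussianPi_eq_withDensity ι, withDensity_apply _ MeasurableSet.univ,
    Measure.restrict_univ] at h1
  have h2 : ∫⁻ c : ι → ℂ, ENNReal.ofReal (gaussianPiDensity c) =
      ENNReal.ofReal ((Real.pi ^ Fintype.card ι)⁻¹) *
        ∫⁻ c : ι → ℂ, ENNReal.ofReal (Real.exp (-∑ i, ‖c i‖ ^ 2)) := by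
    rw [← lintegral_const_mul' _ _ ENNReal.ofReal_ne_top]
    refine lintegral_congr fun c => ?_
    rw [← ENNReal.ofReal_mul (by positivity)]
    rfl
  rw [h2] at h1
  have hπ : 0 < Real.pi ^ Fintype.card ι := by positivity
  have h3 := congrArg (fun x => ENNReal.ofReal (Real.pi ^ Fintype.card ι) * x) h1
  rwa [← mul_assoc, ← ENNReal.ofReal_mul (by positivity), mul_inv_cancel₀ hπ.ne',
    ENNReal.ofReal_one, one_mul, mul_one] at h3


omit [Fintype ι] in
/-- `∑ᵢ |cᵢ|²` is the `nsq` of `Literature.Probability.RandomMatrix`. [folklore] -/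
theorem nsq_eq [Fintype ι] (c : ι → ℂ) : nsq c = ∑ i, ‖c i‖ ^ 2 := rfl

/-- The Gaussian integral `∫ e^{-∑|cᵢ|²/2} dc` over `ι → ℂ` is finite (`= (2π)^{|ι|}`). [folklore] -/
theorem lintegral_exp_neg_nsq_half :
    ∫⁻ c : ι → ℂ, ENNReal.ofReal (Real.exp (-(∑ i, ‖c i‖ ^ 2) / 2)) =
      ENNReal.ofReal (2 ^ Fintype.card ι) * ENNReal.ofReal (Real.pi ^ Fintype.card ι) := by
  have hK : Measurable fun c : ι → ℂ => ENNReal.ofReal (Real.exp (-(∑ i, ‖c i‖ ^ 2) / 2)) := by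
    refine ENNReal.measurable_ofReal.comp (Real.measurable_exp.comp ?_)
    exact (measurable_nsq.neg).div_const 2
  have hr : (0 : ℝ) < Real.sqrt 2 := by positivity
  rw [lintegral_eq_pow_mul_lintegral_smul _ hK hr, ← lintegral_exp_neg_nsq]
  have h2 : Real.sqrt 2 ^ (2 * Fintype.card ι) = 2 ^ Fintype.card ι := by
    rw [pow_mul, Real.sq_sqrt (by norm_num)]
  rw [h2]
  congr 1
  refine lintegral_congr fun v => ?_
  congr 2
  rw [← nsq_eq, ← nsq_eq, nsq_smul, Real.sq_sqrt (by norm_num)]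
  ring

/-- Polynomial moments of the Gaussian weight are finite:
`∫ e^{-∑|cᵢ|²} (∑|cᵢ|²)^p dc < ∞`. [folklore] -/
theorem lintegral_exp_neg_nsq_mul_pow_lt_top (p : ℕ) :
    ∫⁻ c : ι → ℂ, ENNReal.ofReal (Real.exp (-∑ i, ‖c i‖ ^ 2)) *
        ENNReal.ofReal (∑ i, ‖c i‖ ^ 2) ^ p < ⊤ := by
  have hpt : ∀ c : ι → ℂ, ENNReal.ofReal (Real.exp (-∑ i, ‖c i‖ ^ 2)) *
      ENNReal.ofReal (∑ i, ‖c i‖ ^ 2) ^ p ≤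
      ENNReal.ofReal (2 ^ p * p.factorial) *
        ENNReal.ofReal (Real.exp (-(∑ i, ‖c i‖ ^ 2) / 2)) := by
    intro c
    set S : ℝ := ∑ i, ‖c i‖ ^ 2 with hS
    have hS0 : 0 ≤ S := Finset.sum_nonneg fun i _ => by positivity
    rw [← ENNReal.ofReal_pow hS0, ← ENNReal.ofReal_mul (by positivity),
      ← ENNReal.ofReal_mul (by positivity)]
    refine ENNReal.ofReal_le_ofReal ?_
    have h1 : (S / 2) ^ p / p.factorial ≤ Real.exp (S / 2) :=
      Real.pow_div_factorial_le_exp _ (by positivity) p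
    have hfac : (0 : ℝ) < p.factorial := by exact_mod_cast Nat.factorial_pos p
    rw [div_le_iff₀ hfac, div_pow] at h1
    have h2p : (0 : ℝ) < 2 ^ p := by positivity
    rw [div_le_iff₀ h2p] at h1
    have hexp : Real.exp (-S) * Real.exp (S / 2) = Real.exp (-S / 2) := by
      rw [← Real.exp_add]; congr 1; ring
    calc Real.exp (-S) * S ^ p ≤ Real.exp (-S) * (Real.exp (S / 2) * p.factorial * 2 ^ p) :=
          mul_le_mul_of_nonneg_left h1 (Real.exp_pos _).le
      _ = 2 ^ p * p.factorial * Real.exp (-S / 2) := by rw [← hexp]; ring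
  refine lt_of_le_of_lt (lintegral_mono hpt) ?_
  rw [lintegral_const_mul' _ _ ENNReal.ofReal_ne_top, lintegral_exp_neg_nsq_half]
  exact ENNReal.mul_lt_top ENNReal.ofReal_lt_top
    (ENNReal.mul_lt_top ENNReal.ofReal_lt_top ENNReal.ofReal_lt_top)

/-- **Scaling of Gaussian integrals of homogeneous functions.** If `G(t c) = t^{2p} G(c)` for
`t > 0`, then `∫ e^{-∑|cᵢ|²} G = t^{p+|ι|} ∫ e^{-t ∑|cᵢ|²} G` for every `t > 0` (substitute
`c = √t v` in Lebesgue measure on `ι → ℂ ≅ ℝ^{2|ι|}`). [folklore] -/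
theorem lintegral_exp_neg_nsq_mul_eq_pow_mul {G : (ι → ℂ) → ℝ≥0∞} (hG : Measurable G) {p : ℕ}
    (hhom : ∀ t : ℝ, 0 < t → ∀ c : ι → ℂ, G (t • c) = ENNReal.ofReal (t ^ (2 * p)) * G c)
    {t : ℝ} (ht : 0 < t) :
    ∫⁻ c : ι → ℂ, ENNReal.ofReal (Real.exp (-∑ i, ‖c i‖ ^ 2)) * G c =
      ENNReal.ofReal (t ^ (p + Fintype.card ι)) *
        ∫⁻ c : ι → ℂ, ENNReal.ofReal (Real.exp (-(t * ∑ i, ‖c i‖ ^ 2))) * G c := by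
  have hK : Measurable fun c : ι → ℂ => ENNReal.ofReal (Real.exp (-∑ i, ‖c i‖ ^ 2)) * G c :=
    (ENNReal.measurable_ofReal.comp (Real.measurable_exp.comp measurable_nsq.neg)).mul hG
  have hr : (0 : ℝ) < Real.sqrt t := Real.sqrt_pos.2 ht
  rw [lintegral_eq_pow_mul_lintegral_smul _ hK hr]
  have h1 : Real.sqrt t ^ (2 * Fintype.card ι) = t ^ Fintype.card ι := by
    rw [pow_mul, Real.sq_sqrt ht.le]
  have h2 : Real.sqrt t ^ (2 * p) = t ^ p := by
    rw [pow_mul, Real.sq_sqrt ht.le]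
  rw [h1, pow_add, mul_comm (t ^ p), ENNReal.ofReal_mul (by positivity), mul_assoc]
  congr 1
  rw [← lintegral_const_mul' _ _ ENNReal.ofReal_ne_top]
  refine lintegral_congr fun v => ?_
  rw [hhom _ hr v, h2, ← nsq_eq, ← nsq_eq, nsq_smul, Real.sq_sqrt ht.le]
  ring

/-- **Radial lower bound for Gaussian integrals of homogeneous functions.** If
`G : (ι → ℂ) → [0,∞]` is measurable, homogeneous of degree `2p` under positive real dilations and
`∫ e^{-∑|cᵢ|²} G < ∞`, then
`(p + |ι|) ∫ e^{-∑|cᵢ|²} G ≤ ∫ e^{-∑|cᵢ|²} (∑|cᵢ|²) G`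
(in fact equality: the radial moments of `e^{-r²}` against `r^{2p} r^{2|ι|-1} dr` differ by the
factor `Γ(p+|ι|+1)/Γ(p+|ι|) = p + |ι|`; proved here by dilation `t ↦ √t c` and the elementary
inequalities `1 - e^{-x} ≤ x`, `1 + n(t-1) ≤ tⁿ`, letting `t ↓ 1`). [folklore] -/
theorem radial_lintegral_le {G : (ι → ℂ) → ℝ≥0∞} (hG : Measurable G) {p : ℕ}
    (hhom : ∀ t : ℝ, 0 < t → ∀ c : ι → ℂ, G (t • c) = ENNReal.ofReal (t ^ (2 * p)) * G c)
    (hfin : ∫⁻ c : ι → ℂ, ENNReal.ofReal (Real.exp (-∑ i, ‖c i‖ ^ 2)) * G c ≠ ⊤) :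
    ((p + Fintype.card ι : ℕ) : ℝ≥0∞) *
        ∫⁻ c : ι → ℂ, ENNReal.ofReal (Real.exp (-∑ i, ‖c i‖ ^ 2)) * G c ≤
      ∫⁻ c : ι → ℂ, ENNReal.ofReal (Real.exp (-∑ i, ‖c i‖ ^ 2)) *
        ENNReal.ofReal (∑ i, ‖c i‖ ^ 2) * G c := by
  set n : ℕ := p + Fintype.card ι with hn
  set I := ∫⁻ c : ι → ℂ, ENNReal.ofReal (Real.exp (-∑ i, ‖c i‖ ^ 2)) * G c with hI
  set J := ∫⁻ c : ι → ℂ, ENNReal.ofReal (Real.exp (-∑ i, ‖c i‖ ^ 2)) *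
    ENNReal.ofReal (∑ i, ‖c i‖ ^ 2) * G c with hJ
  -- Step 1: for every `t > 1`, `n I ≤ t^n J`.
  have hstep : ∀ t : ℝ, 1 < t → (n : ℝ≥0∞) * I ≤ ENNReal.ofReal (t ^ n) * J := by
    intro t ht1
    have ht : 0 < t := one_pos.trans ht1
    -- `I = t^n I_t`
    have hscale := lintegral_exp_neg_nsq_mul_eq_pow_mul hG hhom ht
    rw [← hI] at hscale
    -- pointwise: `e^{-S} ≤ e^{-tS} + (t-1) S e^{-S}`
    have hpt : ∀ c : ι → ℂ, ENNReal.ofReal (Real.exp (-∑ i, ‖c i‖ ^ 2)) * G c ≤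
        ENNReal.ofReal (Real.exp (-(t * ∑ i, ‖c i‖ ^ 2))) * G c +
          ENNReal.ofReal (t - 1) * (ENNReal.ofReal (Real.exp (-∑ i, ‖c i‖ ^ 2)) *
            ENNReal.ofReal (∑ i, ‖c i‖ ^ 2) * G c) := by
      intro c
      set S : ℝ := ∑ i, ‖c i‖ ^ 2 with hS
      have hS0 : 0 ≤ S := Finset.sum_nonneg fun i _ => by positivity
      have hpos : 0 ≤ (t - 1) * (Real.exp (-S) * S) :=
        mul_nonneg (sub_pos.2 ht1).le (mul_nonneg (Real.exp_pos _).le hS0)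
      have hreal : Real.exp (-S) ≤ Real.exp (-(t * S)) + (t - 1) * (Real.exp (-S) * S) := by
        have h1 : 1 - (t - 1) * S ≤ Real.exp (-((t - 1) * S)) := by
          have := Real.add_one_le_exp (-((t - 1) * S)); linarith
        have h2 : Real.exp (-(t * S)) = Real.exp (-S) * Real.exp (-((t - 1) * S)) := by
          rw [← Real.exp_add]; congr 1; ring
        have h3 : Real.exp (-S) * (1 - (t - 1) * S) ≤ Real.exp (-S) * Real.exp (-((t - 1) * S)) :=
          mul_le_mul_of_nonneg_left h1 (Real.exp_pos _).le
        have h4 : Real.exp (-S) = Real.exp (-S) * (1 - (t - 1) * S) + (t - 1) * (Real.exp (-S) * S) := by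
          ring
        rw [h2]; linarith
      calc ENNReal.ofReal (Real.exp (-S)) * G c
          ≤ ENNReal.ofReal (Real.exp (-(t * S)) + (t - 1) * (Real.exp (-S) * S)) * G c :=
            mul_le_mul_left (ENNReal.ofReal_le_ofReal hreal) _
        _ = _ := by
            rw [ENNReal.ofReal_add (by positivity) hpos,
              ENNReal.ofReal_mul (sub_pos.2 ht1).le, ENNReal.ofReal_mul (Real.exp_pos _).le,
              add_mul, mul_assoc, mul_assoc]
    have hmeasS : Measurable fun c : ι → ℂ => ENNReal.ofReal (∑ i, ‖c i‖ ^ 2) :=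
      ENNReal.measurable_ofReal.comp measurable_nsq
    have hmeasE : Measurable fun c : ι → ℂ => ENNReal.ofReal (Real.exp (-∑ i, ‖c i‖ ^ 2)) :=
      ENNReal.measurable_ofReal.comp (Real.measurable_exp.comp measurable_nsq.neg)
    have hint : I ≤ (∫⁻ c : ι → ℂ, ENNReal.ofReal (Real.exp (-(t * ∑ i, ‖c i‖ ^ 2))) * G c) +
        ENNReal.ofReal (t - 1) * J := by
      calc I ≤ ∫⁻ c : ι → ℂ, (ENNReal.ofReal (Real.exp (-(t * ∑ i, ‖c i‖ ^ 2))) * G c +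
          ENNReal.ofReal (t - 1) * (ENNReal.ofReal (Real.exp (-∑ i, ‖c i‖ ^ 2)) *
            ENNReal.ofReal (∑ i, ‖c i‖ ^ 2) * G c)) := lintegral_mono hpt
        _ = _ := by
          rw [lintegral_add_left, lintegral_const_mul' _ _ ENNReal.ofReal_ne_top]
          exact (ENNReal.measurable_ofReal.comp (Real.measurable_exp.comp
            ((measurable_nsq.const_mul t).neg))).mul hG
    -- multiply by `t^n`
    have htn : (0 : ℝ) < t ^ n := by positivity
    have hmul := mul_le_mul_right hint (ENNReal.ofReal (t ^ n))
    rw [mul_add, ← hscale, ← mul_assoc, ← ENNReal.ofReal_mul htn.le] at hmul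
    -- `t^n I - I ≤ t^n (t-1) J`
    have hsub : (ENNReal.ofReal (t ^ n) - 1) * I ≤ ENNReal.ofReal (t ^ n * (t - 1)) * J := by
      rw [ENNReal.sub_mul fun _ _ => hfin, one_mul]
      exact tsub_le_iff_left.2 hmul
    -- Bernoulli: `n (t-1) ≤ t^n - 1`
    have hbern : (n : ℝ) * (t - 1) ≤ t ^ n - 1 := by
      have := one_add_mul_le_pow (show (-2 : ℝ) ≤ t - 1 by linarith) n
      rw [add_sub_cancel] at this; linarith
    have h3 : ENNReal.ofReal ((n : ℝ) * (t - 1)) * I ≤ ENNReal.ofReal (t ^ n * (t - 1)) * J := by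
      refine le_trans (mul_le_mul_left ?_ I) hsub
      rw [← ENNReal.ofReal_one, ← ENNReal.ofReal_sub _ zero_le_one]
      exact ENNReal.ofReal_le_ofReal hbern
    -- cancel `t - 1`
    have ht1' : ENNReal.ofReal (t - 1) ≠ 0 := by
      rw [ENNReal.ofReal_ne_zero_iff]; linarith
    rw [ENNReal.ofReal_mul (Nat.cast_nonneg n), ENNReal.ofReal_natCast, mul_comm (t ^ n),
      ENNReal.ofReal_mul (sub_pos.2 ht1).le, mul_comm (n : ℝ≥0∞), mul_assoc, mul_assoc] at h3
    exact (ENNReal.mul_le_mul_iff_right ht1' ENNReal.ofReal_ne_top).1 h3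
  -- Step 2: let `t ↓ 1`.
  have htend : Filter.Tendsto (fun t : ℝ => ENNReal.ofReal (t ^ n) * J)
      (nhdsWithin 1 (Set.Ioi 1)) (nhds (ENNReal.ofReal ((1 : ℝ) ^ n) * J)) := by
    refine ENNReal.Tendsto.mul_const ?_ (Or.inl ?_)
    · exact ENNReal.tendsto_ofReal
        ((continuous_pow n).continuousAt.tendsto.mono_left nhdsWithin_le_nhds)
    · simp
  rw [one_pow, ENNReal.ofReal_one, one_mul] at htend
  refine ge_of_tendsto htend ?_
  filter_upwards [self_mem_nhdsWithin] with t ht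
  exact hstep t ht


/-- **Phase rotation of one coordinate preserves Lebesgue measure on `ι → ℂ`**: for a unit complex
number `a` and an index `i₀`, the map `c ↦ (…, a c_{i₀}, …)` is measure preserving (a product of
the rotation `z ↦ az` of `ℂ ≅ ℝ²`, an isometry, with identities). [folklore] -/
theorem measurePreserving_rotate_coord [DecidableEq ι] (i₀ : ι) (a : Circle) :
    MeasurePreserving (fun c : ι → ℂ => fun i => if i = i₀ then (a : ℂ) * c i else c i)
      volume volume := by
  have h := measurePreserving_pi (fun _ : ι => (volume : Measure ℂ)) (fun _ => volume)
    (f := fun i z => if i = i₀ then (a : ℂ) * z else z) (fun i => ?_)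
  · rw [volume_pi]
    exact h
  · by_cases hi : i = i₀
    · simp only [hi, if_true]
      have hr := (rotation a).measurePreserving
      have hcoe : ((rotation a : ℂ ≃ₗᵢ[ℝ] ℂ) : ℂ → ℂ) = fun z => (a : ℂ) * z := by
        funext z; exact rotation_apply a z
      rwa [hcoe] at hr
    · simp only [hi, if_false]
      exact MeasurePreserving.id volume

/-- Rotating one coordinate does not change `∑ᵢ |cᵢ|²`. [folklore] -/
theorem nsq_rotate_coord [DecidableEq ι] (i₀ : ι) (a : Circle) (c : ι → ℂ) :
    (∑ i, ‖(fun i => if i = i₀ then (a : ℂ) * c i else c i) i‖ ^ 2) = ∑ i, ‖c i‖ ^ 2 := by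
  refine Finset.sum_congr rfl fun i _ => ?_
  by_cases hi : i = i₀
  · simp only [hi, if_true, norm_mul, Circle.norm_coe, one_mul]
  · simp only [hi, if_false]



end HusimiConcentration

end Summit.AtomisticToContinuum.BoseEinsteinCondensation.Theorems

end
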